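import Summits.QuantumFields.YangMills.Theorems.BalabanUVNodesN15TwoGridLandauDefectFull
import HarnessLib

/-!
# Route «BalabanUVNodes», node N15 = NE2, -a lane, part 54: DOOR (iv) — ★★★ ENTRY 3 (THE LAPLACIAN LINE) OF `𝔇` FOR BAŁABAN's FULL LANDAU-GAUGE PROPAGATORS `(G′, G)` AT `U ≡ 1`,
# HYPOTHESIS-FREE, through (1.73): `ΔG = 1 + VG − aQ*QG` — no second difference of `G` is ever estimated

Cell `pub-ymgap`, seat `pub-ymgap-dag-n15-a` (KNIT-BY-NAME, g12); `--supports stmt-QuantumFields-20290 --as helper`; `HOME/pub-ymgap-dag-n15-a/DOOR-IV-PLAN.md` §1 ∕ §7.4(b).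
Over parts 53 (`hasMaj_landauDefect_family`), 52 (`hasMaj_twoGridDefect`), 47 (`hasMaj_landauRe`), 46 (`deltaOp_eq`), 45 (`hasMaj_qvRe_comp`, `hasMaj_qvAdjRe_comp`, `hasMaj_qvRe_pull_sub_comp`,
`hasMaj_qvAdjRe_sub_pull_comp`), 42 (`hasMaj_gOp_of_ineq`, `hasMaj_grad_of_ineq`, `ineq110_114_pair`), 39 (`deltaOp_comp_gOp`) and `B11SectG.hasMaj_comp_exp`.
WHAT.  (§60) `entry3_split_apply`: with `Δ = ρ(sLap)` the componentwise lattice Laplacian, `V = landauRe = ∂Π∂*`, `Q = qvRe`, `Q* = qvAdjRe`, `G = Δ_a⁻¹ = gOp`, `P = pull kingPrV` and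
`𝔇 = idef P P G′ G = G′P − PG`: since `Δ = Δ_a + V − aQ*Q` (1.73 = `deltaOp_eq`) and `Δ_aG = 1` on both grids,
`idef P P (Δ′∘G′) (Δ∘G) = V′∘𝔇 + (V′P − PV)∘G − a·[Q′*∘Q′∘𝔇 + Q′*∘(Q′P − Q)∘G + (Q′* − PQ*)∘Q∘G]`.  `hasMaj_entry3_core` (abstract kernels) and `hasMaj_entry3_of_majorants` (one torus,
explicit constants) turn block majorants of `V′`, `𝔇`, `V′P − PV` and the coarse (1.110)–(1.111) package into one for the left side.  (§61) ★★★ **`hasMaj_twoGridDefect_lap`**: for odd `L ≥ 3`,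
`a > 0`, `0 < γ < 1`: `∃ δ C > 0 ∀ m_T, k ≥ 1, m`: `HasMaj (ofBlocks geo blkFine) (ofBlocks geo blockOf_{L^m·L^k}) (idef P P (Δ′∘G′) (Δ∘G)) (C·(L^k)^{−γ∕2}·e^{−δ|y−y′|_T})` — ENTRY 3 of [B9] (3.42)
for `(G′, G)`, HYPOTHESIS-FREE (inputs: part 52 entry 0, part 53, `hasMaj_landauRe`, `ineq110_114_pair` — all tree theorems).
HONEST FRAMING ∕ LIMITS.  `U ≡ 1` torus family; `Δ` = the componentwise lattice Laplacian `ρ(sLap)` of [B5] (1.21) (= [B9]'s covariant `Δ_U` only AT `U ≡ 1`); entries 1–2 (`∇G`, `G∇*`) and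
the node readout `NE2ZeroOperator` NOT here (they need (1.112) with ε-Hölder sources, plan §7.3); count-neutral (typed 28∕28 · discharged 5∕27 of record unchanged); NOT a discharge of N15
(object-bound; NE2⁺ NOT PRINTED); one finite T⁴ at fixed ε — NOT infinite volume, NOT OS on ℝ⁴, NOT a mass gap, NOT Clay.
-/

noncomputable section

open scoped BigOperators Matrix
open Finset

namespace Summit.QuantumFields.YangMills.BalabanUVNodes.N15.TwoGrid

open Literature.MathematicalPhysics.QuantumFieldTheory.Balaban1983to89
open Literature.MathematicalPhysics.QuantumFieldTheory.Balaban1983to89.B11SectG (BlockNorm HasMaj hasMaj_comp_exp)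
open Literature.MathematicalPhysics.QuantumFieldTheory.Balaban1983to89.T4EtaRateCoeffDefect (pull pull_apply)
open Literature.MathematicalPhysics.QuantumFieldTheory.Balaban1983to89.T4EtaRateDefect (idef idef_apply)
open Literature.MathematicalPhysics.QuantumFieldTheory.Balaban1983to89.B5Prop11Plancherel (Tor fine)
open Literature.MathematicalPhysics.QuantumFieldTheory.Balaban1983to89.B5SettingP12Real (latticeSettingP12R)
open Literature.MathematicalPhysics.QuantumFieldTheory.Balaban1983to89.B5SiteBridgeP12 (MP)
open Literature.MathematicalPhysics.QuantumFieldTheory.King1986.Torus (blockOf tdistT tdistT_nonneg)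
open Literature.MathematicalPhysics.QuantumFieldTheory.Balaban1983to89.B6UnitTorusCarrier (unitTorusGeo unitTorusGeo_dist_nonneg triangle254_unitTorusGeo rowSum_unitTorusGeo)
open Summit.QuantumFields.YangMills.BalabanUVNodes.N15.VectorPiece (blkFine kingPrV)

variable {d : ℕ}

/-! ## §60 The (1.73) split of `Δ′G′P − PΔG` and its block majorant on one torus -/

section Split

variable {L : ℕ} [NeZero L] (M : Fin (d + 1) → ℕ) [∀ μ, NeZero (M μ)] (k m : ℕ) (a : ℝ)

/-- ★ **THE (1.73) SPLIT OF ENTRY 3**: `Δ = Δ_a + V − aQ*Q` on both grids (`deltaOp_eq`) and `Δ_aG = 1`, `Δ′_aG′ = 1` (`deltaOp_comp_gOp`) give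
`Δ′G′(Pμ) − P(ΔGμ) = V′(𝔇μ) + (V′P − PV)(Gμ) − a·[Q′*Q′(𝔇μ) + Q′*((Q′P − Q)(Gμ)) + (Q′* − PQ*)(Q(Gμ))]`, `𝔇 = idef P P G′ G` — no second difference of `G` appears.
[cite: Balaban1984PropagatorsI, (1.69)–(1.73) pp.29–30] -/
theorem entry3_split_apply (ha : 0 < a) (μ : Tor (fine (L ^ k) M) × Fin (d + 1) → ℝ) :
    idef (pull (kingPrV L k m M)) (pull (kingPrV L k m M))
        (symbOp M (L ^ m * L ^ k) (sLap M (L ^ m * L ^ k) ((L ^ m * L ^ k : ℕ) : ℝ)) ∘ₗ gOp M (L ^ m * L ^ k) a)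
        (symbOp M (L ^ k) (sLap M (L ^ k) ((L ^ k : ℕ) : ℝ)) ∘ₗ gOp M (L ^ k) a) μ
      = (landauRe M (L ^ m * L ^ k) ∘ₗ idef (pull (kingPrV L k m M)) (pull (kingPrV L k m M)) (gOp M (L ^ m * L ^ k) a) (gOp M (L ^ k) a)) μ
        + ((landauRe M (L ^ m * L ^ k) ∘ₗ pull (kingPrV L k m M) - pull (kingPrV L k m M) ∘ₗ landauRe M (L ^ k)) ∘ₗ gOp M (L ^ k) a) μ
        - a • ((qvAdjRe M (L ^ m * L ^ k) ∘ₗ (qvRe M (L ^ m * L ^ k) ∘ₗ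
                  idef (pull (kingPrV L k m M)) (pull (kingPrV L k m M)) (gOp M (L ^ m * L ^ k) a) (gOp M (L ^ k) a))) μ
              + (qvAdjRe M (L ^ m * L ^ k) ∘ₗ ((qvRe M (L ^ m * L ^ k) ∘ₗ pull (kingPrV L k m M) - qvRe M (L ^ k)) ∘ₗ gOp M (L ^ k) a)) μ
              + ((qvAdjRe M (L ^ m * L ^ k) - pull (kingPrV L k m M) ∘ₗ qvAdjRe M (L ^ k)) ∘ₗ (qvRe M (L ^ k) ∘ₗ gOp M (L ^ k) a)) μ) := by
  have hL0 : 0 < L := Nat.pos_of_ne_zero (NeZero.ne L)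
  have hn1 : 1 ≤ L ^ k := Nat.one_le_pow _ _ hL0
  have hn'1 : 1 ≤ L ^ m * L ^ k := Nat.one_le_iff_ne_zero.mpr (Nat.mul_ne_zero (by positivity) (by positivity))
  -- `Δ_aG = 1` on both grids
  have h2 : deltaOp M (L ^ k) a (gOp M (L ^ k) a μ) = μ := by
    simpa using LinearMap.congr_fun (deltaOp_comp_gOp M (L ^ k) a hn1 ha) μ
  have h2' : deltaOp M (L ^ m * L ^ k) a (gOp M (L ^ m * L ^ k) a (pull (kingPrV L k m M) μ)) = pull (kingPrV L k m M) μ := by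
    simpa using LinearMap.congr_fun (deltaOp_comp_gOp M (L ^ m * L ^ k) a hn'1 ha) (pull (kingPrV L k m M) μ)
  -- (1.73) read as `Δ = Δ_a + V − aQ*Q`
  have hLap : ∀ (n : ℕ) [NeZero n] (x : Tor (fine n M) × Fin (d + 1) → ℝ),
      symbOp M n (sLap M n ((n : ℕ) : ℝ)) x = deltaOp M n a x + landauRe M n x - a • qvAdjRe M n (qvRe M n x) := by
    intro n _ x
    rw [deltaOp_eq, LinearMap.add_apply, LinearMap.sub_apply, LinearMap.smul_apply, LinearMap.comp_apply]
    abel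
  simp only [idef_apply, LinearMap.comp_apply, LinearMap.sub_apply, hLap, h2, h2', map_sub, map_add, map_smul, smul_add, smul_sub]
  abel

/-- **ENTRY 3 FROM FIVE MAJORANTS (one torus, abstract kernels)**: majorants `K₁ … K₅` of `V′∘𝔇`, `(V′P − PV)∘G`, `Q′*∘Q′∘𝔇`, `Q′*∘(Q′P − Q)∘G`, `(Q′* − PQ*)∘Q∘G` give the majorant
`K₁ + K₂ + |a|·(K₃ + K₄ + K₅)` of `idef P P (Δ′∘G′) (Δ∘G)` (`entry3_split_apply`). [folklore] -/
theorem hasMaj_entry3_core (ha : 0 < a) {b₁ : BlockNorm (unitTorusGeo L k M) (Tor (fine (L ^ k) M) × Fin (d + 1) → ℝ)} {K₁ K₂ K₃ K₄ K₅ : Tor M → Tor M → ℝ}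
    (hK : ∀ y y', 0 ≤ K₃ y y' + K₄ y y' + K₅ y y')
    (h₁ : HasMaj b₁ (BlockNorm.ofBlocks (unitTorusGeo L k M) (fun i : Tor (fine (L ^ m * L ^ k) M) × Fin (d + 1) => blockOf (L ^ m * L ^ k) M i.1))
      (landauRe M (L ^ m * L ^ k) ∘ₗ idef (pull (kingPrV L k m M)) (pull (kingPrV L k m M)) (gOp M (L ^ m * L ^ k) a) (gOp M (L ^ k) a)) K₁)
    (h₂ : HasMaj b₁ (BlockNorm.ofBlocks (unitTorusGeo L k M) (fun i : Tor (fine (L ^ m * L ^ k) M) × Fin (d + 1) => blockOf (L ^ m * L ^ k) M i.1))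
      ((landauRe M (L ^ m * L ^ k) ∘ₗ pull (kingPrV L k m M) - pull (kingPrV L k m M) ∘ₗ landauRe M (L ^ k)) ∘ₗ gOp M (L ^ k) a) K₂)
    (h₃ : HasMaj b₁ (BlockNorm.ofBlocks (unitTorusGeo L k M) (fun i : Tor (fine (L ^ m * L ^ k) M) × Fin (d + 1) => blockOf (L ^ m * L ^ k) M i.1))
      (qvAdjRe M (L ^ m * L ^ k) ∘ₗ (qvRe M (L ^ m * L ^ k) ∘ₗ
        idef (pull (kingPrV L k m M)) (pull (kingPrV L k m M)) (gOp M (L ^ m * L ^ k) a) (gOp M (L ^ k) a))) K₃)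
    (h₄ : HasMaj b₁ (BlockNorm.ofBlocks (unitTorusGeo L k M) (fun i : Tor (fine (L ^ m * L ^ k) M) × Fin (d + 1) => blockOf (L ^ m * L ^ k) M i.1))
      (qvAdjRe M (L ^ m * L ^ k) ∘ₗ ((qvRe M (L ^ m * L ^ k) ∘ₗ pull (kingPrV L k m M) - qvRe M (L ^ k)) ∘ₗ gOp M (L ^ k) a)) K₄)
    (h₅ : HasMaj b₁ (BlockNorm.ofBlocks (unitTorusGeo L k M) (fun i : Tor (fine (L ^ m * L ^ k) M) × Fin (d + 1) => blockOf (L ^ m * L ^ k) M i.1))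
      ((qvAdjRe M (L ^ m * L ^ k) - pull (kingPrV L k m M) ∘ₗ qvAdjRe M (L ^ k)) ∘ₗ (qvRe M (L ^ k) ∘ₗ gOp M (L ^ k) a)) K₅) :
    HasMaj b₁ (BlockNorm.ofBlocks (unitTorusGeo L k M) (fun i : Tor (fine (L ^ m * L ^ k) M) × Fin (d + 1) => blockOf (L ^ m * L ^ k) M i.1))
      (idef (pull (kingPrV L k m M)) (pull (kingPrV L k m M))
        (symbOp M (L ^ m * L ^ k) (sLap M (L ^ m * L ^ k) ((L ^ m * L ^ k : ℕ) : ℝ)) ∘ₗ gOp M (L ^ m * L ^ k) a)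
        (symbOp M (L ^ k) (sLap M (L ^ k) ((L ^ k : ℕ) : ℝ)) ∘ₗ gOp M (L ^ k) a))
      (fun y y' => K₁ y y' + K₂ y y' + |a| * (K₃ y y' + K₄ y y' + K₅ y y')) := by
  have g := hasMaj_smul_ofBlocks (g := unitTorusGeo L k M) (fun i : Tor (fine (L ^ m * L ^ k) M) × Fin (d + 1) => blockOf (L ^ m * L ^ k) M i.1) hK a
    ((h₃.add h₄).add h₅)
  refine ((h₁.add h₂).sub g).congr fun μ => ?_
  rw [LinearMap.sub_apply, LinearMap.add_apply, LinearMap.smul_apply, LinearMap.add_apply, LinearMap.add_apply, entry3_split_apply M k m a ha μ]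

/-- **ENTRY 3 ON ONE TORUS, EXPLICIT CONSTANTS**: the coarse member's (1.110)–(1.111) package `HP1` (for `G` and `∇G`) plus block majorants `A₁e^{−ρd}` of `V′`, `A₂e^{−ρd}` of
`𝔇 = idef P P G′ G` and `A₃e^{−ρd}` of `V′P − PV` (`0 < ρ ≤ δ₀`) give
`HasMaj (ofBlocks geo blkFine) (ofBlocks geo blockOf′) (idef P P (Δ′∘G′) (Δ∘G)) ([(A₁A₂ + A₃C₀)·K(ρ∕2) + a·(A₂ + 3(L^k)⁻¹C₀)·e^{2ρ}]·e^{−(ρ∕2)d})`, `K(σ) = latticeConst (d+1) σ`.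
[cite: Balaban1984PropagatorsI, (1.69)–(1.73) pp.29–30, Prop. 1.2 (1.110)–(1.111) p.35, (1.18) p.20] -/
theorem hasMaj_entry3_of_majorants (ha : 0 < a) {C₀ δ₀ : ℝ} {Cα Cε : ℝ → ℝ} {Cαε : ℝ → ℝ → ℝ} (hC₀ : 0 < C₀)
    (HP1 : B5.Ineq110_114 (latticeSettingP12R (L ^ k) M a k) C₀ Cα Cε Cαε δ₀) {ρ A₁ A₂ A₃ : ℝ} (hρ : 0 < ρ) (hρδ : ρ ≤ δ₀) (hA₁ : 0 ≤ A₁) (hA₂ : 0 ≤ A₂) (hA₃ : 0 ≤ A₃)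
    (hV : HasMaj (BlockNorm.ofBlocks (unitTorusGeo L k M) (fun i : Tor (fine (L ^ m * L ^ k) M) × Fin (d + 1) => blockOf (L ^ m * L ^ k) M i.1))
      (BlockNorm.ofBlocks (unitTorusGeo L k M) (fun i : Tor (fine (L ^ m * L ^ k) M) × Fin (d + 1) => blockOf (L ^ m * L ^ k) M i.1))
      (landauRe M (L ^ m * L ^ k)) (fun y y' => A₁ * Real.exp (-(ρ * tdistT M y y'))))
    (hD : HasMaj (BlockNorm.ofBlocks (unitTorusGeo L k M) (blkFine L k M))
      (BlockNorm.ofBlocks (unitTorusGeo L k M) (fun i : Tor (fine (L ^ m * L ^ k) M) × Fin (d + 1) => blockOf (L ^ m * L ^ k) M i.1))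
      (idef (pull (kingPrV L k m M)) (pull (kingPrV L k m M)) (gOp M (L ^ m * L ^ k) a) (gOp M (L ^ k) a)) (fun y y' => A₂ * Real.exp (-(ρ * tdistT M y y'))))
    (hVd : HasMaj (BlockNorm.ofBlocks (unitTorusGeo L k M) (blkFine L k M))
      (BlockNorm.ofBlocks (unitTorusGeo L k M) (fun i : Tor (fine (L ^ m * L ^ k) M) × Fin (d + 1) => blockOf (L ^ m * L ^ k) M i.1))
      (landauRe M (L ^ m * L ^ k) ∘ₗ pull (kingPrV L k m M) - pull (kingPrV L k m M) ∘ₗ landauRe M (L ^ k)) (fun y y' => A₃ * Real.exp (-(ρ * tdistT M y y')))) :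
    HasMaj (BlockNorm.ofBlocks (unitTorusGeo L k M) (blkFine L k M))
      (BlockNorm.ofBlocks (unitTorusGeo L k M) (fun i : Tor (fine (L ^ m * L ^ k) M) × Fin (d + 1) => blockOf (L ^ m * L ^ k) M i.1))
      (idef (pull (kingPrV L k m M)) (pull (kingPrV L k m M))
        (symbOp M (L ^ m * L ^ k) (sLap M (L ^ m * L ^ k) ((L ^ m * L ^ k : ℕ) : ℝ)) ∘ₗ gOp M (L ^ m * L ^ k) a)
        (symbOp M (L ^ k) (sLap M (L ^ k) ((L ^ k : ℕ) : ℝ)) ∘ₗ gOp M (L ^ k) a))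
      (fun y y' => ((A₁ * A₂ + A₃ * C₀) * B4Sect5Proof.latticeConst (d + 1) (ρ / 2) + a * ((A₂ + 3 * ((L ^ k : ℕ) : ℝ)⁻¹ * C₀) * Real.exp ρ * Real.exp ρ))
        * Real.exp (-(ρ / 2 * tdistT M y y'))) := by
  classical
  have hσ0 : 0 < ρ / 2 := by linarith
  have hL0 : 0 < L := Nat.pos_of_ne_zero (NeZero.ne L)
  have hLr : (0 : ℝ) < L := by exact_mod_cast hL0
  have hn1 : 1 ≤ L ^ k := Nat.one_le_pow _ _ hL0
  have hn0 : (0 : ℝ) < ((L ^ k : ℕ) : ℝ) := by exact_mod_cast hn1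
  have hLk : ((L : ℝ) ^ k) = ((L ^ k : ℕ) : ℝ) := by push_cast; ring
  have he0 : 0 ≤ Real.exp ρ := Real.exp_nonneg _
  set bC := BlockNorm.ofBlocks (unitTorusGeo L k M) (blkFine L k M) with hbC
  set bF := BlockNorm.ofBlocks (unitTorusGeo L k M) (fun i : Tor (fine (L ^ m * L ^ k) M) × Fin (d + 1) => blockOf (L ^ m * L ^ k) M i.1) with hbF
  -- the coarse member: `G` and `η⁻¹·∇_κG` at rate `ρ ≤ δ₀`
  have hweak : ∀ {C : ℝ} (_ : 0 ≤ C) (y y' : Tor M), C * Real.exp (-(δ₀ * tdistT M y y')) ≤ C * Real.exp (-(ρ * tdistT M y y')) :=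
    fun hC y y' => mul_le_mul_of_nonneg_left (Real.exp_le_exp.mpr (by nlinarith [tdistT_nonneg M y y'])) hC
  have hG : HasMaj bC (BlockNorm.ofBlocks (unitTorusGeo L k M) (fun i : Tor (fine (L ^ k) M) × Fin (d + 1) => blockOf (L ^ k) M i.1)) (gOp M (L ^ k) a)
      (fun y y' => C₀ * Real.exp (-(ρ * tdistT M y y'))) :=
    (hasMaj_gOp_of_ineq M k (L ^ k) a hn1 HP1 hC₀.le).mono fun y y' => hweak hC₀.le y y'
  have hgrad : ∀ κ : Fin (d + 1), HasMaj bC (BlockNorm.ofBlocks (unitTorusGeo L k M) (blkFine L k M))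
      ((((L ^ k : ℕ) : ℝ)⁻¹ • symbOp M (L ^ k) (sD M (L ^ k) κ ((L ^ k : ℕ) : ℝ))) ∘ₗ gOp M (L ^ k) a)
      (fun y y' => ((L ^ k : ℕ) : ℝ)⁻¹ * C₀ * Real.exp (-(ρ * tdistT M y y'))) := by
    intro κ
    have h0 := (hasMaj_grad_of_ineq (L := L) M k (L ^ k) a hn1 HP1 hC₀.le κ).mono fun y y' => hweak hC₀.le y y'
    rw [LinearMap.smul_comp]
    refine (hasMaj_smul_ofBlocks (g := unitTorusGeo L k M) (blkFine L k M) (fun y y' => mul_nonneg hC₀.le (Real.exp_nonneg _)) (((L ^ k : ℕ) : ℝ)⁻¹) h0).mono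
      fun y y' => le_of_eq ?_
    rw [abs_of_nonneg (inv_nonneg.mpr hn0.le), mul_assoc]
  -- (1) `V′∘𝔇` and (2) `(V′P − PV)∘G` by composition
  have h1 := hasMaj_comp_exp (b₁ := bC) (b₂ := bF) (b₃ := bF) (triangle254_unitTorusGeo L k M) (unitTorusGeo_dist_nonneg L k M) (rowSum_unitTorusGeo L k M hσ0)
    hA₁ hA₂ hσ0.le (by linarith) (by linarith) hV hD
  have h2 := hasMaj_comp_exp (b₁ := bC) (b₂ := bC) (b₃ := bF) (triangle254_unitTorusGeo L k M) (unitTorusGeo_dist_nonneg L k M) (rowSum_unitTorusGeo L k M hσ0)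
    hA₃ hC₀.le hσ0.le (by linarith) (by linarith) hVd hG
  -- (3) `Q′*Q′∘𝔇`, (4) `Q′*(Q′P − Q)∘G`, (5) `(Q′* − PQ*)∘Q∘G`
  have h3 := hasMaj_qvAdjRe_comp M k (L ^ m * L ^ k) (b₁ := bC) (mul_nonneg hA₂ he0) hρ.le (hasMaj_qvRe_comp M k (L ^ m * L ^ k) (b₁ := bC) hA₂ hρ.le hD)
  have hA4 : 0 ≤ ((L ^ k : ℕ) : ℝ)⁻¹ * C₀ := mul_nonneg (inv_nonneg.mpr hn0.le) hC₀.le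
  have h4 := hasMaj_qvAdjRe_comp M k (L ^ m * L ^ k) (b₁ := bC) (mul_nonneg hA4 he0) hρ.le (hasMaj_qvRe_pull_sub_comp M k m (b₁ := bC) hA4 hρ.le hgrad)
  have h5 := hasMaj_qvAdjRe_sub_pull_comp M k m (b₁ := bC) (mul_nonneg hC₀.le he0) hρ.le (hasMaj_qvRe_comp M k (L ^ k) (b₁ := bC) hC₀.le hρ.le hG)
  -- sum
  have hκF : bF.κ = 1 := rfl
  have hκC : bC.κ = 1 := rfl
  refine (hasMaj_entry3_core M k m a ha (fun y y' => by positivity) h1 h2 h3 h4 h5).mono fun y y' => ?_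
  have hE : Real.exp (-(ρ * tdistT M y y')) ≤ Real.exp (-(ρ / 2 * tdistT M y y')) := Real.exp_le_exp.mpr (by nlinarith [tdistT_nonneg M y y'])
  have hY : 0 ≤ a * ((A₂ + 3 * ((L ^ k : ℕ) : ℝ)⁻¹ * C₀) * Real.exp ρ * Real.exp ρ) := by positivity
  rw [hκF, hκC, abs_of_pos ha, hLk]
  calc 1 * A₁ * A₂ * B4Sect5Proof.latticeConst (d + 1) (ρ / 2) * Real.exp (-(ρ / 2 * tdistT M y y'))
        + 1 * A₃ * C₀ * B4Sect5Proof.latticeConst (d + 1) (ρ / 2) * Real.exp (-(ρ / 2 * tdistT M y y'))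
        + a * (A₂ * Real.exp ρ * Real.exp ρ * Real.exp (-(ρ * tdistT M y y')) + (((L ^ k : ℕ) : ℝ))⁻¹ * C₀ * Real.exp ρ * Real.exp ρ * Real.exp (-(ρ * tdistT M y y'))
          + 2 * Real.exp ρ / ((L ^ k : ℕ) : ℝ) * (C₀ * Real.exp ρ) * Real.exp (-(ρ * tdistT M y y')))
      = (A₁ * A₂ + A₃ * C₀) * B4Sect5Proof.latticeConst (d + 1) (ρ / 2) * Real.exp (-(ρ / 2 * tdistT M y y'))
        + a * ((A₂ + 3 * ((L ^ k : ℕ) : ℝ)⁻¹ * C₀) * Real.exp ρ * Real.exp ρ) * Real.exp (-(ρ * tdistT M y y')) := by rw [div_eq_mul_inv]; ring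
    _ ≤ (A₁ * A₂ + A₃ * C₀) * B4Sect5Proof.latticeConst (d + 1) (ρ / 2) * Real.exp (-(ρ / 2 * tdistT M y y'))
        + a * ((A₂ + 3 * ((L ^ k : ℕ) : ℝ)⁻¹ * C₀) * Real.exp ρ * Real.exp ρ) * Real.exp (-(ρ / 2 * tdistT M y y')) :=
          add_le_add le_rfl (mul_le_mul_of_nonneg_left hE hY)
    _ = _ := by ring

end Split

/-! ## §61 ★★★ Entry 3 of `𝔇` for `(G′, G)` on the torus family, hypothesis-free -/

section Family

variable {L : ℕ} [NeZero L]

/-- ★★★ **ENTRY 3 (THE LAPLACIAN LINE) OF THE TWO-GRID DEFECT FOR BAŁABAN's FULL LANDAU-GAUGE PROPAGATORS AT `U ≡ 1`, HYPOTHESIS-FREE.**  For odd `L ≥ 3`, `a > 0` and `0 < γ < 1`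
there are `δ, C > 0` such that for every torus exponent `m_T`, coarse scale `k ≥ 1` (`η = L^{−k}`) and refinement `m` (`η′ = η∕L^m`), with `G = Δ_a⁻¹ = gOp M (L^k) a`, `G′` on the
fine grid, King's prolongation `P = pull kingPrV`, and `Δ = ρ(sLap)` the componentwise lattice Laplacian (1.21) on both grids:
`HasMaj (ofBlocks geo blkFine) (ofBlocks geo blockOf_{L^m·L^k}) (idef P P (Δ′∘G′) (Δ∘G)) (C·(L^k)^{−γ∕2}·e^{−δ|y−y′|_T})` — the operator `Δ′G′P − PΔG` is `O(η^{γ∕2})` in block-majorant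
currency with exponential off-diagonal decay on the unit torus.  MECHANISM: (1.73) `Δ = Δ_a + ∂Π∂* − aQ*Q`, `Δ_aG = 1` (`entry3_split_apply`); entry 0 (part 52 `hasMaj_twoGridDefect`),
the Landau defect (part 53 `hasMaj_landauDefect_family`), `hasMaj_landauRe`, the averaging pieces of part 45 with the (1.110)–(1.111) package (`ineq110_114_pair`).
[cite: Balaban1984PropagatorsI, (1.69)–(1.73) pp.29–30, Prop. 1.2 (1.110)–(1.111) p.35, (1.126) p.38; Balaban1985BackgroundPropagators, (3.42) p.397 (third entry, shape);
King1986, Prop. 3.9 (3.73) p.665 (η-rate shape)] -/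
theorem hasMaj_twoGridDefect_lap (hLodd : Odd L) (hL2 : 2 ≤ L) {a : ℝ} (ha : 0 < a) {γ : ℝ} (hγ0 : 0 < γ) (hγ1 : γ < 1) :
    ∃ δ C : ℝ, 0 < δ ∧ 0 < C ∧ ∀ (mT k m : ℕ) (_hk : 1 ≤ k) (hL : Odd L ∧ 1 < L),
      HasMaj (BlockNorm.ofBlocks (unitTorusGeo L k (MP (paramsOf d L mT k hL))) (blkFine L k (MP (paramsOf d L mT k hL))))
        (BlockNorm.ofBlocks (unitTorusGeo L k (MP (paramsOf d L mT k hL)))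
          (fun i : Tor (fine (L ^ m * L ^ k) (MP (paramsOf d L mT k hL))) × Fin (d + 1) => blockOf (L ^ m * L ^ k) (MP (paramsOf d L mT k hL)) i.1))
        (idef (pull (kingPrV L k m (MP (paramsOf d L mT k hL)))) (pull (kingPrV L k m (MP (paramsOf d L mT k hL))))
          (symbOp (MP (paramsOf d L mT k hL)) (L ^ m * L ^ k) (sLap (MP (paramsOf d L mT k hL)) (L ^ m * L ^ k) ((L ^ m * L ^ k : ℕ) : ℝ)) ∘ₗ
            gOp (MP (paramsOf d L mT k hL)) (L ^ m * L ^ k) a)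
          (symbOp (MP (paramsOf d L mT k hL)) (L ^ k) (sLap (MP (paramsOf d L mT k hL)) (L ^ k) ((L ^ k : ℕ) : ℝ)) ∘ₗ gOp (MP (paramsOf d L mT k hL)) (L ^ k) a))
        (fun y y' => C * ((L ^ k : ℕ) : ℝ) ^ (-(γ / 2)) * Real.exp (-(δ * tdistT (MP (paramsOf d L mT k hL)) y y'))) := by
  have hL : Odd L ∧ 1 < L := ⟨hLodd, by omega⟩
  obtain ⟨δ₀, C₀, Cα, Cε, Cαε, hδ₀, hC₀, HP⟩ := ineq110_114_pair (d := d) hL ha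
  obtain ⟨δ₁, C₁, hδ₁, hC₁, HV⟩ := hasMaj_landauRe (d := d) (L := L)
  obtain ⟨δ₂, C₂, hδ₂, hC₂, HD⟩ := hasMaj_twoGridDefect (d := d) hLodd hL2 ha hγ0 hγ1
  obtain ⟨δ₃, C₃, hδ₃, hC₃, HVd⟩ := hasMaj_landauDefect_family (d := d) hLodd hL2 ha hγ0 hγ1
  obtain ⟨ρ, hρ⟩ : ∃ ρ : ℝ, ρ = min (min δ₀ δ₁) (min δ₂ δ₃) := ⟨_, rfl⟩
  have hρpos : 0 < ρ := hρ ▸ lt_min (lt_min hδ₀ hδ₁) (lt_min hδ₂ hδ₃)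
  have hρ0 : ρ ≤ δ₀ := hρ ▸ (min_le_left _ _).trans (min_le_left _ _)
  have hρ1 : ρ ≤ δ₁ := hρ ▸ (min_le_left _ _).trans (min_le_right _ _)
  have hρ2 : ρ ≤ δ₂ := hρ ▸ (min_le_right _ _).trans (min_le_left _ _)
  have hρ3 : ρ ≤ δ₃ := hρ ▸ (min_le_right _ _).trans (min_le_right _ _)
  have hc0 : 0 ≤ B4Sect5Proof.latticeConst (d + 1) (ρ / 2) := B4Sect5Proof.latticeConst_nonneg _ (by positivity)
  obtain ⟨C, hC⟩ : ∃ C : ℝ, C = (C₁ * C₂ + C₃ * C₀) * B4Sect5Proof.latticeConst (d + 1) (ρ / 2) + a * ((C₂ + 3 * C₀) * Real.exp ρ * Real.exp ρ) + 1 := ⟨_, rfl⟩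
  have hCpos : 0 < C := hC ▸ by positivity
  refine ⟨ρ / 2, C, by positivity, hCpos, fun mT k m hk hL' => ?_⟩
  have hn1 : (1 : ℝ) ≤ ((L ^ k : ℕ) : ℝ) := by exact_mod_cast Nat.one_le_pow _ _ (Nat.pos_of_ne_zero (NeZero.ne L))
  have hn0 : (0 : ℝ) < ((L ^ k : ℕ) : ℝ) := by linarith
  have hrγ : 0 ≤ ((L ^ k : ℕ) : ℝ) ^ (-(γ / 2)) := Real.rpow_nonneg hn0.le _
  have hinv : ((L ^ k : ℕ) : ℝ)⁻¹ ≤ ((L ^ k : ℕ) : ℝ) ^ (-(γ / 2)) := by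
    rw [← Real.rpow_neg_one]
    exact Real.rpow_le_rpow_of_exponent_le hn1 (by linarith)
  -- the four inputs at the common rate `ρ`
  have hweak : ∀ {B δ' : ℝ} (_ : 0 ≤ B) (_ : ρ ≤ δ') (y y' : Tor (MP (paramsOf d L mT k hL))),
      B * Real.exp (-(δ' * tdistT (MP (paramsOf d L mT k hL)) y y')) ≤ B * Real.exp (-(ρ * tdistT (MP (paramsOf d L mT k hL)) y y')) :=
    fun hB hδ y y' => mul_le_mul_of_nonneg_left (Real.exp_le_exp.mpr (by nlinarith [tdistT_nonneg (MP (paramsOf d L mT k hL)) y y'])) hB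
  have hV := (HV k (L ^ m * L ^ k) (MP (paramsOf d L mT k hL))).mono fun y y' => hweak hC₁.le hρ1 y y'
  have hD := (HD mT k m hk hL).mono fun y y' => hweak (mul_nonneg hC₂.le hrγ) hρ2 y y'
  have hVd := (HVd mT k m hk hL).mono fun y y' => hweak (mul_nonneg hC₃.le hrγ) hρ3 y y'
  refine (hasMaj_entry3_of_majorants (MP (paramsOf d L mT k hL)) k m a ha hC₀ (HP mT k m hk).1 hρpos hρ0 hC₁.le (mul_nonneg hC₂.le hrγ) (mul_nonneg hC₃.le hrγ)
    hV hD hVd).mono fun y y' => mul_le_mul_of_nonneg_right ?_ (Real.exp_nonneg _)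
  -- the constant: `(L^k)⁻¹ ≤ (L^k)^{−γ/2}`
  have hX : 0 ≤ a * ((3 * C₀) * Real.exp ρ * Real.exp ρ) := by positivity
  have hcoef : 0 ≤ (C₁ * C₂ + C₃ * C₀) * B4Sect5Proof.latticeConst (d + 1) (ρ / 2) + a * ((C₂ + 3 * C₀) * Real.exp ρ * Real.exp ρ) := by positivity
  calc (C₁ * (C₂ * ((L ^ k : ℕ) : ℝ) ^ (-(γ / 2))) + C₃ * ((L ^ k : ℕ) : ℝ) ^ (-(γ / 2)) * C₀) * B4Sect5Proof.latticeConst (d + 1) (ρ / 2)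
        + a * ((C₂ * ((L ^ k : ℕ) : ℝ) ^ (-(γ / 2)) + 3 * ((L ^ k : ℕ) : ℝ)⁻¹ * C₀) * Real.exp ρ * Real.exp ρ)
      = ((C₁ * C₂ + C₃ * C₀) * B4Sect5Proof.latticeConst (d + 1) (ρ / 2) + a * (C₂ * Real.exp ρ * Real.exp ρ)) * ((L ^ k : ℕ) : ℝ) ^ (-(γ / 2))
        + a * ((3 * C₀) * Real.exp ρ * Real.exp ρ) * ((L ^ k : ℕ) : ℝ)⁻¹ := by ring
    _ ≤ ((C₁ * C₂ + C₃ * C₀) * B4Sect5Proof.latticeConst (d + 1) (ρ / 2) + a * (C₂ * Real.exp ρ * Real.exp ρ)) * ((L ^ k : ℕ) : ℝ) ^ (-(γ / 2))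
        + a * ((3 * C₀) * Real.exp ρ * Real.exp ρ) * ((L ^ k : ℕ) : ℝ) ^ (-(γ / 2)) := add_le_add le_rfl (mul_le_mul_of_nonneg_left hinv hX)
    _ = ((C₁ * C₂ + C₃ * C₀) * B4Sect5Proof.latticeConst (d + 1) (ρ / 2) + a * ((C₂ + 3 * C₀) * Real.exp ρ * Real.exp ρ)) * ((L ^ k : ℕ) : ℝ) ^ (-(γ / 2)) := by ring
    _ ≤ C * ((L ^ k : ℕ) : ℝ) ^ (-(γ / 2)) := mul_le_mul_of_nonneg_right (by rw [hC]; linarith) hrγ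

end Family

end Summit.QuantumFields.YangMills.BalabanUVNodes.N15.TwoGrid
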